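import Summits.QuantumFields.YangMills.Theorems.BalabanUVNodesN19TargetAtRecord13CoPH
import Summits.QuantumFields.YangMills.Theorems.BalabanUVNodesN19TargetAtHomes13CoPHOnVacuumMGF
import Literature.MathematicalPhysics.QuantumFieldTheory.Balaban1983to89.Node00.Record13SepCoPH
import Summits.QuantumFields.YangMills.Theses.BalabanUVNodes

/-! v1.7 `CoPH` EDITION (FINDING №9; director-ym №183 H1ʰ∕№186 (α)∕№190 PRESS; def-T FILE 27 p537939 + 28T `Node00/Record13SepCoPH.lean` p539169; plan rev 24∕25 d502235e0b6b;
dag-lead WORDS-143 l.20907: K3⁷ `SpineGivenEndpointR13SepCoPH` = stmt-QuantumFields-20544) of my landed v1.6 route-facing module 33ᴿ (`…N19TargetK3R13SepCoPRReading` p532962∕p542462,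
STANDS on the aside item 20509) under T₇ (`copr2coph_tokmap.py`: `CoPR ↦ CoPH`, `Stage13RParams ↦ Stage13HParams`, `ZrUnity ↦ ZhUnity`, `unityNondeg₁₃R ↦ unityNondeg₁₃H`): K3⁷ BY NAME
(the rev-24 K-text IS the rev-22 text under T₇), bridges `Provisos₁₃SepCoPH.toCore` ∕ `datumOfRecord₁₃SepCoPH_eq_coPH` (28T), faces of module 23ᶜᵒᴾᴴ p543022.  COUNT-NEUTRAL; K3⁷ NOT claimed;
hypotheses throughout; NE7 NOT PRINTED∕proved; N19 NOT discharged.  Seat `pub-ymgap-dag-n19-d` gen 9.  Below: the v1.6 header under T₇ (names substituted; p-ids = ORIGINAL modules). -/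
/-!
# BalabanUVNodes ∕ N19 (NE7 proper) — the LIVE route crux K3⁷ `SpineGivenEndpointR13SepCoPH` (stmt-QuantumFields-20544, route rev 24∕25 — plan NEW-IDS-24 ∕ dag-lead WORDS-143; FINDING №9, director-ym №183∕№186∕№190) READ IN N19's CURRENCY over the
# CoPH faces: node U5's DECL target `T4ApexVariance.MatchingUnder` at every guarded admissible v1.7 (`SepCoPH`) Stage-13 datum of record (`N = 2`) — the v1.7 twin of module 29∕33 §1
# (`…N19TargetK3R13SepReading`, p507136 ∕ v1.1 p512801) over module 23ᶜᵒᴾᴴ (`…N19TargetAtRecord13CoPH`) by ONE `h.toCore` per binder (plan g67 CORE-YES; def-T KEY-RULE-21 R4∕R5)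

Cell `pub-ymgap` (HUMAN RULING D-0062, Track A), R134 ACCELERATION seat `pub-ymgap-dag-n19-d` (strategy s2), gen 9, module 33ᴴ.  This file imports the route file BECAUSE its theorems
carry the route decl `Summit.QuantumFields.YangMills.Theses.BalabanUVNodes.SpineGivenEndpointR13SepCoPH` in their TYPE (director LINE №103 (1) rule; nothing imports this file); everything
else of the N19 knit lives in the Theses-free modules.  Filed `--kind proof --supports stmt-QuantumFields-20544 --as helper` (K3⁷, dag-lead WORDS-143).  COUNT-NEUTRAL.  NO theorem below has the bare item as its
type (all are `… → SpineGivenEndpointR13SepCoPH` or `↔`); nothing is claimed.  THE JUNCTION: def-T FILE 22T `Node00/Record13SepCoPH.lean` defines `datumOfRecord₁₃SepCoPH F N θ h :=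
datumOfRecord₁₃CoPH F N θ h.toCore` (`datumOfRecord₁₃SepCoPH_eq_coPH : … = … := rfl`), so every CoPH-keyed face of module 23ᶜᵒᴾᴴ (quantified over ALL tuples with `Provisos₁₃CoPH`) reads at
the item's `SepCoPH` tuples by `h.toCore`, and the item-level worlds-free statement follows from the Co RECORD class (which contains every `SepCoPH` datum).
* §1 the reading: K3⁷ ⟺ «for every family, every Stage-13 tuple θ with v1.7 provisos `Provisos₁₃SepCoPH`, print's partition of unity and non-degenerate present slots (`θ.ZhUnity F 2 ∧
  θ.SlotsNondegenerate₁₃ F 2`), admissible: `MatchingUnder (Node00.datumOfRecord₁₃SepCoPH F 2 θ h) END`» (module 23ᶜᵒᴾᴴᴾᴴ `hybridNE7Under_datumOfRecord₁₃CoPH_iff_matchingUnder` at `h.toCore`,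
  the item's displayed `(B) → END →` prefix absorbed); K3⁷ from N19's target at every CoPH RECORD (module 23ᶜᵒᴾᴴᴾᴴ `forall_record₁₃CoPH_matchingUnder_iff_forall_datumOfRecord₁₃CoPH`,
  worlds eliminated; the guard and the `SepCoPH` rows only weaken); and ★ K3⁷ from the CHILDREN's θ-INDEXED FACES ON THE SAME CoPH TUPLE — N20 `RelWeightBound` ∕ N21
  `ShellWeightBound` at a spine reading `cr`, K4's six rates at a rate reading `rr`, the N19′ edge and the keyed extraction clause (module 23ᶜᵒᴾᴴᴾᴴ `matchingUnder_at_record₁₃CoPH_of_keyedFaces`),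
  and the same with the edge PRODUCED by a source-split reading (module 23ᶜᵒᴾᴴᴾᴴ `coreEdge_keyed₁₃CoPH_of_sourceSplitReading`, dag-n19-e's (V)+(I) currency).
* §2∕§3 (v1.1, APPEND-ONLY — the CoPH homes are in the tree: n27-c `…SpineCarriersOfRecord13CoPH` ∕ `…N27AtRecord13CoPHHomeOn`, n22-e `…RateCarriersOfRecord13CoPH(On)`, my 24ᶜᵒᴾ
  p528583 ∕ 24bᶜᵒᴾ): the item from the stubs at the GUARD-restricted v1.6 HOMES `SRec₁₃CoPHOn` ∕ `RRec₁₃CoPHOn` and a source-split ∕ insertion-derivative ∕ vacuum-MGF ∕ vacuum-ledger-pieces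
  reading (modules 24ᶜᵒᴾ∕24bᶜᵒᴾ by name), each composed with §1's `…_of_forall_guarded_matchingUnder_datumOfRecord₁₃CoPH` (one `h.toCore`); §1 byte-identical, one more import.

HONEST FRAMING.  Bookkeeping: `↔`∕`→` re-readings of the item in node U5's letters; every stub, reading and edge is a HYPOTHESIS (0∕1 at the record today); (V)+(I) NOT PRINTED; nothing
of Bałaban's is asserted or instantiated; NE7 ∕ NE7b ∕ NE7c NOT PRINTED for d = 4, NOT PROVED; NO node is discharged; K3⁷ NOT claimed (not vetted either); no `SepCoPH` inhabitant claimed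
(K0⁵ open); counts UNMOVED (typed 28∕28 · discharged 5∕27, A 5∕28); one finite four-torus programme at fixed `ε = L^{−K}` — NOT ℝ⁴, NOT infinite volume, NOT OS, NOT a mass gap, NOT
Clay.  0 `def`, 0 `sorry`; no decl below carries a cite tag (bookkeeping [folklore]).
-/

open Finset

namespace Summit.QuantumFields.YangMills.BalabanUVNodes.N19TargetK3R13SepCoPHReading

open Literature.MathematicalPhysics.QuantumFieldTheory.Balaban1983to89
open Literature.MathematicalPhysics.QuantumFieldTheory.Balaban1983to89.T4Continuum
open T4WeightBudget (RelWeightBound)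
open T4IndicatorShell (ShellWeightBound)
open T4ContinuumYM4Torus (ForSmallCouplings)
open T4ApexVariance (MatchingUnder)
open Summit.QuantumFields.BalabanUV.T4Continuum.Spine
open Summit.QuantumFields.YangMills.Theses.BalabanUVNodes (SpineGivenEndpointR13SepCoPH)
open Summit.QuantumFields.YangMills.BalabanUVNodes.N19TargetAtRecord13CoPH (hybridNE7Under_datumOfRecord₁₃CoPH_iff_matchingUnder
  forall_record₁₃CoPH_matchingUnder_iff_forall_datumOfRecord₁₃CoPH matchingUnder_at_record₁₃CoPH_of_keyedFaces coreEdge_keyed₁₃CoPH_of_sourceSplitReading)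
open YMDAG.UVSplit
open Node00 (Stage13HParams datumOfRecord₁₃CoPH datumOfRecord₁₃SepCoPH IsRecordOfRecord₁₃CCoPH)

/-! ## §1 The reading of K3⁷ in node U5's currency over the CoPH faces, and K3⁷ from the children's θ-indexed faces on the same tuple -/

/-- **K3⁷ ⟹ N19's TARGET AT EVERY GUARDED ADMISSIBLE v1.7 STAGE-13 DATUM** [bookkeeping]: from `SpineGivenEndpointR13SepCoPH`, at every `θ` with provisos `h : θ.Provisos₁₃SepCoPH F 2`, the
guard `θ.ZhUnity F 2 ∧ θ.SlotsNondegenerate₁₃ F 2` and `θ.Admissible F 2`: `MatchingUnder (datumOfRecord₁₃SepCoPH F 2 θ h) END` (the item's displayed `(B) → END →` prefix is fed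
B5-under-END's own antecedents; then the degenerate expansion at the Core(Co) datum `datumOfRecord₁₃CoPH F 2 θ h.toCore`, which the `SepCoPH` datum IS by `rfl` — module 23ᶜᵒ). [folklore] -/
theorem matchingUnder_datumOfRecord₁₃SepCoPH_of_spineGivenEndpointR13SepCoPH (hK : SpineGivenEndpointR13SepCoPH) (F : T4Family) (θ : Stage13HParams F 2)
    (h : θ.Provisos₁₃SepCoPH F 2) (hG : θ.ZhUnity F 2 ∧ θ.SlotsNondegenerate₁₃ F 2) (hθ : θ.Admissible F 2) :
    MatchingUnder (datumOfRecord₁₃SepCoPH F 2 θ h) (DagBinding.EndpointExistence (datumOfRecord₁₃SepCoPH F 2 θ h).C.toB12) := by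
  rw [Node00.datumOfRecord₁₃SepCoPH_eq_coPH]
  exact (hybridNE7Under_datumOfRecord₁₃CoPH_iff_matchingUnder θ h.toCore _).mp fun hB hE => by
    have hK' := hK F θ h hG hθ
    rw [Node00.datumOfRecord₁₃SepCoPH_eq_coPH] at hK'
    exact hK' hB hE hB hE

/-- **N19's TARGET AT EVERY GUARDED ADMISSIBLE v1.7 STAGE-13 DATUM ⟹ K3⁷** [bookkeeping] (the displayed (B)∕END hypotheses are discarded — B5 under END carries its own). [folklore] -/
theorem spineGivenEndpointR13SepCoPH_of_forall_guarded_matchingUnder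
    (h : ∀ (F : T4Family) (θ : Stage13HParams F 2) (hP : θ.Provisos₁₃SepCoPH F 2), θ.ZhUnity F 2 ∧ θ.SlotsNondegenerate₁₃ F 2 → θ.Admissible F 2 →
      MatchingUnder (datumOfRecord₁₃SepCoPH F 2 θ hP) (DagBinding.EndpointExistence (datumOfRecord₁₃SepCoPH F 2 θ hP).C.toB12)) :
    SpineGivenEndpointR13SepCoPH := by
  intro F θ hP hG hθ _ _
  have h' := h F θ hP hG hθ
  rw [Node00.datumOfRecord₁₃SepCoPH_eq_coPH] at h' ⊢
  exact (hybridNE7Under_datumOfRecord₁₃CoPH_iff_matchingUnder θ hP.toCore _).mpr h'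

/-- **THE READING: K3⁷ `SpineGivenEndpointR13SepCoPH` ⟺ N19's DECL TARGET AT EVERY GUARDED ADMISSIBLE v1.7 STAGE-13 DATUM OF RECORD** [bookkeeping] — at `N = 2`, for every
family, every Stage-13 tuple `θ` with provisos `Provisos₁₃SepCoPH` (separated (2.18) indices, print's background `UbgOfRecord₁₃CoPH`), print's partition of unity and non-degenerate
present slots, admissible: `T4ApexVariance.MatchingUnder (Node00.datumOfRecord₁₃SepCoPH F 2 θ h) END`. [folklore] -/
theorem spineGivenEndpointR13SepCoPH_iff_forall_guarded_matchingUnder :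
    SpineGivenEndpointR13SepCoPH ↔ ∀ (F : T4Family) (θ : Stage13HParams F 2) (h : θ.Provisos₁₃SepCoPH F 2), θ.ZhUnity F 2 ∧ θ.SlotsNondegenerate₁₃ F 2 → θ.Admissible F 2 →
      MatchingUnder (datumOfRecord₁₃SepCoPH F 2 θ h) (DagBinding.EndpointExistence (datumOfRecord₁₃SepCoPH F 2 θ h).C.toB12) :=
  ⟨matchingUnder_datumOfRecord₁₃SepCoPH_of_spineGivenEndpointR13SepCoPH, spineGivenEndpointR13SepCoPH_of_forall_guarded_matchingUnder⟩

/-- **K3⁷ FROM N19's TARGET AT EVERY GUARDED ADMISSIBLE CoPH DATUM** [bookkeeping]: the CoPH-keyed θ-indexed statement (ALL tuples with `Provisos₁₃CoPH`, module 23ᶜᵒ's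
currency) implies the item — one `h.toCore` per binder (plan g67 CORE-YES: consumers key ONCE on Core(Co); item-keyed junctions are this thin). [folklore] -/
theorem spineGivenEndpointR13SepCoPH_of_forall_guarded_matchingUnder_datumOfRecord₁₃CoPH
    (h : ∀ (F : T4Family) (θ : Stage13HParams F 2) (hP : θ.Provisos₁₃CoPH F 2), θ.ZhUnity F 2 ∧ θ.SlotsNondegenerate₁₃ F 2 → θ.Admissible F 2 →
      MatchingUnder (datumOfRecord₁₃CoPH F 2 θ hP) (DagBinding.EndpointExistence (datumOfRecord₁₃CoPH F 2 θ hP).C.toB12)) :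
    SpineGivenEndpointR13SepCoPH :=
  spineGivenEndpointR13SepCoPH_of_forall_guarded_matchingUnder fun F θ hP hG hθ => by
    rw [Node00.datumOfRecord₁₃SepCoPH_eq_coPH]; exact h F θ hP.toCore hG hθ

/-- **N19's TARGET AT EVERY CORE(Co) STAGE-13 RECORD GIVES K3⁷** [bookkeeping]: «`MatchingUnder D END` at every `Node00.IsRecordOfRecord₁₃CCoPH F 2 D w`» — the conclusion shape of
module 23ᶜᵒ's closers `matchingUnder_at_record₁₃CoPH_of_spineRates ∕ _of_rateStubs(_tail) ∕ _of_termBudgetReading ∕ _of_keyedFaces ∕ …` at `N = 2` — implies `SpineGivenEndpointR13SepCoPH`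
(worlds eliminated by def-T's `exists_world_isRecordOfRecord₁₃CCoPH`, module 23ᶜᵒᴾᴴ `forall_record₁₃CoPH_matchingUnder_iff_forall_datumOfRecord₁₃CoPH`; the guard and the `SepCoPH` rows only
weaken). [folklore] -/
theorem spineGivenEndpointR13SepCoPH_of_forall_record₁₃CoPH_matchingUnder
    (h : ∀ (F : T4Family) (D : Datum F 2) (w : DagBinding.WorldP), IsRecordOfRecord₁₃CCoPH F 2 D w → MatchingUnder D (DagBinding.EndpointExistence D.C.toB12)) :
    SpineGivenEndpointR13SepCoPH :=
  spineGivenEndpointR13SepCoPH_of_forall_guarded_matchingUnder_datumOfRecord₁₃CoPH fun F θ hP _ hθ =>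
    forall_record₁₃CoPH_matchingUnder_iff_forall_datumOfRecord₁₃CoPH.mp h F θ hP hθ

section KeyedFaces

variable (cr : ∀ {F : T4Family} (θ : Stage13HParams F 2), θ.Provisos₁₃CoPH F 2 → (ℕ → ℝ) → List (ULoop F) → SpineCarriers)
  (rr : ∀ {F : T4Family} (θ : Stage13HParams F 2), θ.Provisos₁₃CoPH F 2 → (ℕ → ℝ) → List (ULoop F) → RateCarriers 2)

/-- **★ K3⁷ FROM THE CHILDREN's θ-INDEXED ESTIMATES ON THE SAME CoPH TUPLE — plan g67's K3 skeleton shapes, unbundled, at the key consumers hold** [bookkeeping] (module 23ᶜᵒᴾᴴᴾᴴ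
`matchingUnder_at_record₁₃CoPH_of_keyedFaces` at `N = 2`, then `spineGivenEndpointR13SepCoPH_of_forall_record₁₃CoPH_matchingUnder`): for readings `cr` (spine carriers) and `rr` (rate carriers)
off the Core(Co) tuples `(θ, hP : θ.Provisos₁₃CoPH F 2)` — N20 `RelWeightBound` and N21 `ShellWeightBound` at `cr θ hP g₀ os`, K4's six rates jointly at `rr θ hP g₀ os` on
`datumOfRecord₁₃CoPH F 2 θ hP`, the SAME-TUPLE N19′ edge (the rates ⇒ SOME summable `δ` with `Spine.NE7.Core` on the shell-free cores) and the keyed extraction clause (positivity + E1∕E2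
under (B), END, small tuned couplings), each for EVERY admissible θ with core provisos ⇒ `SpineGivenEndpointR13SepCoPH`.  Every face a HYPOTHESIS (0∕1). [folklore] -/
theorem spineGivenEndpointR13SepCoPH_of_keyedFaces
    (h20 : ∀ (F : T4Family) (θ : Stage13HParams F 2) (hP : θ.Provisos₁₃CoPH F 2), θ.Admissible F 2 → ∀ (g₀ : ℕ → ℝ) (os : List (ULoop F)),
      RelWeightBound (cr θ hP g₀ os).l₀ (cr θ hP g₀ os).T (cr θ hP g₀ os).A (cr θ hP g₀ os).B (cr θ hP g₀ os).Bad (cr θ hP g₀ os).W)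
    (h21 : ∀ (F : T4Family) (θ : Stage13HParams F 2) (hP : θ.Provisos₁₃CoPH F 2), θ.Admissible F 2 → ∀ (g₀ : ℕ → ℝ) (os : List (ULoop F)),
      ShellWeightBound (cr θ hP g₀ os).l₀ (cr θ hP g₀ os).T (cr θ hP g₀ os).A (cr θ hP g₀ os).B (cr θ hP g₀ os).shA (cr θ hP g₀ os).shB (cr θ hP g₀ os).Wsh)
    (hrates : ∀ (F : T4Family) (θ : Stage13HParams F 2) (hP : θ.Provisos₁₃CoPH F 2), θ.Admissible F 2 → ∀ (g₀ : ℕ → ℝ) (os : List (ULoop F)),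
      RatesAt (datumOfRecord₁₃CoPH F 2 θ hP) (rr θ hP g₀ os))
    (h19 : ∀ (F : T4Family) (θ : Stage13HParams F 2) (hP : θ.Provisos₁₃CoPH F 2), θ.Admissible F 2 → ∀ (g₀ : ℕ → ℝ) (os : List (ULoop F)),
      RatesAt (datumOfRecord₁₃CoPH F 2 θ hP) (rr θ hP g₀ os) → letI := (cr θ hP g₀ os).dec
        ∃ δ : ℕ → ℝ, NE7.Core (cr θ hP g₀ os).l₀ (cr θ hP g₀ os).vol (cr θ hP g₀ os).T (cr θ hP g₀ os).Bad
          (fun K t τ => (cr θ hP g₀ os).A K t τ - (cr θ hP g₀ os).shA K t τ) (fun K t τ => (cr θ hP g₀ os).B K t τ - (cr θ hP g₀ os).shB K t τ) δ ∧ Summable δ)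
    (hx : ∀ (F : T4Family) (θ : Stage13HParams F 2) (hP : θ.Provisos₁₃CoPH F 2), θ.Admissible F 2 →
      B16.EndStatementBPrinted (datumOfRecord₁₃CoPH F 2 θ hP).C → DagBinding.EndpointExistence (datumOfRecord₁₃CoPH F 2 θ hP).C.toB12 →
        ForSmallCouplings (datumOfRecord₁₃CoPH F 2 θ hP) fun g₀ => ∀ os : List (ULoop F),
          0 < (cr θ hP g₀ os).l₀ ∧ 0 < (cr θ hP g₀ os).vol ∧
          (∀ (K : ℕ) (t : ℝ), |t| ≤ (cr θ hP g₀ os).l₀ →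
            T4GenFunBounds.schemeZ ((datumOfRecord₁₃CoPH F 2 θ hP).scheme g₀) os ((cr θ hP g₀ os).K₀ + K) t = ∑ τ ∈ (cr θ hP g₀ os).T K, (cr θ hP g₀ os).A K t τ) ∧
          (∀ (K : ℕ) (t : ℝ), |t| ≤ (cr θ hP g₀ os).l₀ →
            T4GenFunBounds.schemeZ ((datumOfRecord₁₃CoPH F 2 θ hP).scheme g₀) os ((cr θ hP g₀ os).K₀ + K + 1) t =
              ∑ τ ∈ (cr θ hP g₀ os).T K, (cr θ hP g₀ os).B K t τ)) :
    SpineGivenEndpointR13SepCoPH :=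
  spineGivenEndpointR13SepCoPH_of_forall_record₁₃CoPH_matchingUnder fun _ _ _ hR =>
    matchingUnder_at_record₁₃CoPH_of_keyedFaces cr rr h20 h21 hrates h19 hx hR

/-- **… WITH THE N19′ EDGE PRODUCED BY A SOURCE-SPLIT READING** [bookkeeping] (module 23ᶜᵒᴾᴴᴾᴴ `coreEdge_keyed₁₃CoPH_of_sourceSplitReading`, dag-n19-e's located (V)+(I) currency
`N19SourceSplit.core_of_vacuum_of_insertion`): the same with `h19` replaced by «at every admissible θ with core provisos, every `g₀`, `os`, GIVEN the rates at `rr θ hP g₀ os`: positive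
shell-free cores on the good classes + (V) a class-uniform VACUUM matching + (I) a per-class SOURCE-RESPONSE matching with SUMMABLE `δ⁰`, `δ¹`».  Every input a HYPOTHESIS today. [folklore] -/
theorem spineGivenEndpointR13SepCoPH_of_keyedFaces_sourceSplit
    (h20 : ∀ (F : T4Family) (θ : Stage13HParams F 2) (hP : θ.Provisos₁₃CoPH F 2), θ.Admissible F 2 → ∀ (g₀ : ℕ → ℝ) (os : List (ULoop F)),
      RelWeightBound (cr θ hP g₀ os).l₀ (cr θ hP g₀ os).T (cr θ hP g₀ os).A (cr θ hP g₀ os).B (cr θ hP g₀ os).Bad (cr θ hP g₀ os).W)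
    (h21 : ∀ (F : T4Family) (θ : Stage13HParams F 2) (hP : θ.Provisos₁₃CoPH F 2), θ.Admissible F 2 → ∀ (g₀ : ℕ → ℝ) (os : List (ULoop F)),
      ShellWeightBound (cr θ hP g₀ os).l₀ (cr θ hP g₀ os).T (cr θ hP g₀ os).A (cr θ hP g₀ os).B (cr θ hP g₀ os).shA (cr θ hP g₀ os).shB (cr θ hP g₀ os).Wsh)
    (hrates : ∀ (F : T4Family) (θ : Stage13HParams F 2) (hP : θ.Provisos₁₃CoPH F 2), θ.Admissible F 2 → ∀ (g₀ : ℕ → ℝ) (os : List (ULoop F)),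
      RatesAt (datumOfRecord₁₃CoPH F 2 θ hP) (rr θ hP g₀ os))
    (hread : ∀ (F : T4Family) (θ : Stage13HParams F 2) (hP : θ.Provisos₁₃CoPH F 2), θ.Admissible F 2 → ∀ (g₀ : ℕ → ℝ) (os : List (ULoop F)),
      RatesAt (datumOfRecord₁₃CoPH F 2 θ hP) (rr θ hP g₀ os) → letI := (cr θ hP g₀ os).dec
      (∀ K t, |t| ≤ (cr θ hP g₀ os).l₀ → ∀ τ ∈ (cr θ hP g₀ os).T K \ (cr θ hP g₀ os).Bad K t,
        0 < (cr θ hP g₀ os).A K t τ - (cr θ hP g₀ os).shA K t τ ∧ 0 < (cr θ hP g₀ os).B K t τ - (cr θ hP g₀ os).shB K t τ) ∧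
      ∃ δ₀ δ₁ : ℕ → ℝ, Summable δ₀ ∧ Summable δ₁ ∧
        (∀ K, ∃ c : ℝ, ∀ t : ℝ, |t| ≤ (cr θ hP g₀ os).l₀ → ∀ τ ∈ (cr θ hP g₀ os).T K \ (cr θ hP g₀ os).Bad K t,
          |Real.log ((cr θ hP g₀ os).B K 0 τ - (cr θ hP g₀ os).shB K 0 τ) - Real.log ((cr θ hP g₀ os).A K 0 τ - (cr θ hP g₀ os).shA K 0 τ) - c| ≤
            (cr θ hP g₀ os).vol * δ₀ K) ∧
        (∀ K (t : ℝ), |t| ≤ (cr θ hP g₀ os).l₀ → ∀ τ ∈ (cr θ hP g₀ os).T K \ (cr θ hP g₀ os).Bad K t,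
          |(Real.log ((cr θ hP g₀ os).B K t τ - (cr θ hP g₀ os).shB K t τ) - Real.log ((cr θ hP g₀ os).A K t τ - (cr θ hP g₀ os).shA K t τ)) -
              (Real.log ((cr θ hP g₀ os).B K 0 τ - (cr θ hP g₀ os).shB K 0 τ) - Real.log ((cr θ hP g₀ os).A K 0 τ - (cr θ hP g₀ os).shA K 0 τ))| ≤
            (cr θ hP g₀ os).vol * δ₁ K))
    (hx : ∀ (F : T4Family) (θ : Stage13HParams F 2) (hP : θ.Provisos₁₃CoPH F 2), θ.Admissible F 2 →
      B16.EndStatementBPrinted (datumOfRecord₁₃CoPH F 2 θ hP).C → DagBinding.EndpointExistence (datumOfRecord₁₃CoPH F 2 θ hP).C.toB12 →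
        ForSmallCouplings (datumOfRecord₁₃CoPH F 2 θ hP) fun g₀ => ∀ os : List (ULoop F),
          0 < (cr θ hP g₀ os).l₀ ∧ 0 < (cr θ hP g₀ os).vol ∧
          (∀ (K : ℕ) (t : ℝ), |t| ≤ (cr θ hP g₀ os).l₀ →
            T4GenFunBounds.schemeZ ((datumOfRecord₁₃CoPH F 2 θ hP).scheme g₀) os ((cr θ hP g₀ os).K₀ + K) t = ∑ τ ∈ (cr θ hP g₀ os).T K, (cr θ hP g₀ os).A K t τ) ∧
          (∀ (K : ℕ) (t : ℝ), |t| ≤ (cr θ hP g₀ os).l₀ →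
            T4GenFunBounds.schemeZ ((datumOfRecord₁₃CoPH F 2 θ hP).scheme g₀) os ((cr θ hP g₀ os).K₀ + K + 1) t =
              ∑ τ ∈ (cr θ hP g₀ os).T K, (cr θ hP g₀ os).B K t τ)) :
    SpineGivenEndpointR13SepCoPH :=
  spineGivenEndpointR13SepCoPH_of_keyedFaces cr rr h20 h21 hrates (coreEdge_keyed₁₃CoPH_of_sourceSplitReading (N := 2) cr rr hread) hx

end KeyedFaces

/-! ## §2 (v1.1, APPEND-ONLY; v1.7 edition over the CoPH homes 24ᶜᵒᴾᴴ∕24bᶜᵒᴾᴴ) The item from the stubs at the GUARD-restricted Stage-13 CoPH homes and a SOURCE-SPLIT reading (module 24ᶜᵒᴾᴴ by name) -/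

section GuardHomes

open Summit.QuantumFields.YangMills.BalabanUVNodes.N19TargetAtHomes13CoPHOn (matchingUnder_guarded_datumOfRecord₁₃CoPH_of_homes₁₃CoPHOn
  matchingUnder_guarded_datumOfRecord₁₃CoPH_of_homes₁₃CoPHOn_sourceSplit towerEdge₁₃CoPHOn_of_insertionDerivReading)

variable (cr : SpineReading₁₃CoPH 2) (𝔯 : RateReading₁₃CoPH 2)

/-- **K3⁷ FROM THE STUBS AT THE GUARD-RESTRICTED STAGE-13 CoPH HOMES AND A SOURCE-SPLIT READING** [bookkeeping] (`N = 2`, regime = the item's guard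
`θ.ZhUnity F 2 ∧ θ.SlotsNondegenerate₁₃ F 2`): the six in-edges BY NAME at `RRec₁₃CoPHOn 𝔯 Rg` (`S_N14` · `S_N15` · `S_N16` · `S_N17` · `S_N18` · `S_N22`, each its node's estimate asked ONLY of
guarded admissible tuples, read at θ), `S_N20` ∕ `S_N21` at `SRec₁₃CoPHOn cr Rg`, the guarded keyed extraction clause (positivity + E1∕E2 under (B), END, small tuned couplings), and a
SOURCE-SPLIT reading of `cr` at the guarded tuples — given the rates at every run length of `𝔯`: positive shell-free cores on the good classes, (V) a class-uniform VACUUM matching and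
(I) a per-class SOURCE-RESPONSE matching of `log (B − shB) − log (A − shA)` with summable `δ⁰`, `δ¹` — ⇒ `SpineGivenEndpointR13SepCoPH` (module 24ᶜᵒᴾᴴ
`matchingUnder_guarded_datumOfRecord₁₃CoPH_of_homes₁₃CoPHOn_sourceSplit` ∘ `spineGivenEndpointR13SepCoPH_of_forall_guarded_matchingUnder_datumOfRecord₁₃CoPH`, one `h.toCore`).  Every input a HYPOTHESIS; (V)∕(I) NOT PRINTED. [folklore] -/
theorem spineGivenEndpointR13SepCoPH_of_homes₁₃CoPHOn_sourceSplit
    (h14 : S_N14 (RRec₁₃CoPHOn 𝔯 fun F θ => θ.ZhUnity F 2 ∧ θ.SlotsNondegenerate₁₃ F 2)) (h15 : S_N15 (RRec₁₃CoPHOn 𝔯 fun F θ => θ.ZhUnity F 2 ∧ θ.SlotsNondegenerate₁₃ F 2))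
    (h16 : S_N16 (RRec₁₃CoPHOn 𝔯 fun F θ => θ.ZhUnity F 2 ∧ θ.SlotsNondegenerate₁₃ F 2)) (h17 : S_N17 (RRec₁₃CoPHOn 𝔯 fun F θ => θ.ZhUnity F 2 ∧ θ.SlotsNondegenerate₁₃ F 2))
    (h18 : S_N18 (RRec₁₃CoPHOn 𝔯 fun F θ => θ.ZhUnity F 2 ∧ θ.SlotsNondegenerate₁₃ F 2)) (h22 : S_N22 (RRec₁₃CoPHOn 𝔯 fun F θ => θ.ZhUnity F 2 ∧ θ.SlotsNondegenerate₁₃ F 2))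
    (h20 : S_N20 (SRec₁₃CoPHOn cr fun F θ => θ.ZhUnity F 2 ∧ θ.SlotsNondegenerate₁₃ F 2)) (h21 : S_N21 (SRec₁₃CoPHOn cr fun F θ => θ.ZhUnity F 2 ∧ θ.SlotsNondegenerate₁₃ F 2))
    (hx : ∀ (F : T4Family) (θ : Stage13HParams F 2) (hP : θ.Provisos₁₃CoPH F 2), θ.ZhUnity F 2 ∧ θ.SlotsNondegenerate₁₃ F 2 → θ.Admissible F 2 →
      B16.EndStatementBPrinted (datumOfRecord₁₃CoPH F 2 θ hP).C → DagBinding.EndpointExistence (datumOfRecord₁₃CoPH F 2 θ hP).C.toB12 →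
        T4ContinuumYM4Torus.ForSmallCouplings (datumOfRecord₁₃CoPH F 2 θ hP) fun g₀ => ∀ os : List (ULoop F),
          0 < (cr F θ hP g₀ os).l₀ ∧ 0 < (cr F θ hP g₀ os).vol ∧
          (∀ (K : ℕ) (t : ℝ), |t| ≤ (cr F θ hP g₀ os).l₀ →
            T4GenFunBounds.schemeZ ((datumOfRecord₁₃CoPH F 2 θ hP).scheme g₀) os ((cr F θ hP g₀ os).K₀ + K) t =
              ∑ τ ∈ (cr F θ hP g₀ os).T K, (cr F θ hP g₀ os).A K t τ) ∧
          (∀ (K : ℕ) (t : ℝ), |t| ≤ (cr F θ hP g₀ os).l₀ →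
            T4GenFunBounds.schemeZ ((datumOfRecord₁₃CoPH F 2 θ hP).scheme g₀) os ((cr F θ hP g₀ os).K₀ + K + 1) t =
              ∑ τ ∈ (cr F θ hP g₀ os).T K, (cr F θ hP g₀ os).B K t τ))
    (hread : ∀ (F : T4Family) (θ : Stage13HParams F 2) (hP : θ.Provisos₁₃CoPH F 2), θ.ZhUnity F 2 ∧ θ.SlotsNondegenerate₁₃ F 2 → θ.Admissible F 2 →
      ∀ (g₀ : ℕ → ℝ) (os : List (ULoop F)),
      (∀ k : ℕ, RatesAt (datumOfRecord₁₃CoPH F 2 θ hP) (rateCarriersOfRecord₁₃CoPH 𝔯 F θ hP g₀ os k)) → letI := (cr F θ hP g₀ os).dec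
      (∀ K t, |t| ≤ (cr F θ hP g₀ os).l₀ → ∀ τ ∈ (cr F θ hP g₀ os).T K \ (cr F θ hP g₀ os).Bad K t,
        0 < (cr F θ hP g₀ os).A K t τ - (cr F θ hP g₀ os).shA K t τ ∧ 0 < (cr F θ hP g₀ os).B K t τ - (cr F θ hP g₀ os).shB K t τ) ∧
      ∃ δ₀ δ₁ : ℕ → ℝ, Summable δ₀ ∧ Summable δ₁ ∧
        (∀ K, ∃ c : ℝ, ∀ t : ℝ, |t| ≤ (cr F θ hP g₀ os).l₀ → ∀ τ ∈ (cr F θ hP g₀ os).T K \ (cr F θ hP g₀ os).Bad K t,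
          |Real.log ((cr F θ hP g₀ os).B K 0 τ - (cr F θ hP g₀ os).shB K 0 τ) - Real.log ((cr F θ hP g₀ os).A K 0 τ - (cr F θ hP g₀ os).shA K 0 τ) - c| ≤
            (cr F θ hP g₀ os).vol * δ₀ K) ∧
        (∀ K (t : ℝ), |t| ≤ (cr F θ hP g₀ os).l₀ → ∀ τ ∈ (cr F θ hP g₀ os).T K \ (cr F θ hP g₀ os).Bad K t,
          |(Real.log ((cr F θ hP g₀ os).B K t τ - (cr F θ hP g₀ os).shB K t τ) - Real.log ((cr F θ hP g₀ os).A K t τ - (cr F θ hP g₀ os).shA K t τ)) -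
              (Real.log ((cr F θ hP g₀ os).B K 0 τ - (cr F θ hP g₀ os).shB K 0 τ) - Real.log ((cr F θ hP g₀ os).A K 0 τ - (cr F θ hP g₀ os).shA K 0 τ))| ≤
            (cr F θ hP g₀ os).vol * δ₁ K)) :
    SpineGivenEndpointR13SepCoPH :=
  spineGivenEndpointR13SepCoPH_of_forall_guarded_matchingUnder_datumOfRecord₁₃CoPH fun F θ hP hG hθ =>
    matchingUnder_guarded_datumOfRecord₁₃CoPH_of_homes₁₃CoPHOn_sourceSplit cr 𝔯 (fun F θ => θ.ZhUnity F 2 ∧ θ.SlotsNondegenerate₁₃ F 2)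
      h14 h15 h16 h17 h18 h22 h20 h21 hx hread F θ hP hG hθ

/-- **K3⁷ FROM THE STUBS AT THE GUARD-RESTRICTED STAGE-13 CoPH HOMES AND AN INSERTION-DERIVATIVE READING** [bookkeeping] (`N = 2`; the same with (I) replaced by the agreement of the
two runs' TILTED INSERTION MEANS: at every guarded admissible tuple, given the rates at every run length, `0 < vol`, positive shell-free cores on the good classes, (V) with summable
`δ⁰`, source-differentiable log-cores on `[−l₀, l₀]` with derivatives `mA`, `mB` and `|mB − mA| ≤ Λ_K` along the source segment of every good class, `0 ≤ Λ` summable ⇒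
`SpineGivenEndpointR13SepCoPH`; module 24ᶜᵒᴾᴴ `towerEdge₁₃CoPHOn_of_insertionDerivReading` produces the edge, `matchingUnder_guarded_datumOfRecord₁₃CoPH_of_homes₁₃CoPHOn` consumes it). [folklore] -/
theorem spineGivenEndpointR13SepCoPH_of_homes₁₃CoPHOn_insertionDeriv
    (h14 : S_N14 (RRec₁₃CoPHOn 𝔯 fun F θ => θ.ZhUnity F 2 ∧ θ.SlotsNondegenerate₁₃ F 2)) (h15 : S_N15 (RRec₁₃CoPHOn 𝔯 fun F θ => θ.ZhUnity F 2 ∧ θ.SlotsNondegenerate₁₃ F 2))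
    (h16 : S_N16 (RRec₁₃CoPHOn 𝔯 fun F θ => θ.ZhUnity F 2 ∧ θ.SlotsNondegenerate₁₃ F 2)) (h17 : S_N17 (RRec₁₃CoPHOn 𝔯 fun F θ => θ.ZhUnity F 2 ∧ θ.SlotsNondegenerate₁₃ F 2))
    (h18 : S_N18 (RRec₁₃CoPHOn 𝔯 fun F θ => θ.ZhUnity F 2 ∧ θ.SlotsNondegenerate₁₃ F 2)) (h22 : S_N22 (RRec₁₃CoPHOn 𝔯 fun F θ => θ.ZhUnity F 2 ∧ θ.SlotsNondegenerate₁₃ F 2))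
    (h20 : S_N20 (SRec₁₃CoPHOn cr fun F θ => θ.ZhUnity F 2 ∧ θ.SlotsNondegenerate₁₃ F 2)) (h21 : S_N21 (SRec₁₃CoPHOn cr fun F θ => θ.ZhUnity F 2 ∧ θ.SlotsNondegenerate₁₃ F 2))
    (hx : ∀ (F : T4Family) (θ : Stage13HParams F 2) (hP : θ.Provisos₁₃CoPH F 2), θ.ZhUnity F 2 ∧ θ.SlotsNondegenerate₁₃ F 2 → θ.Admissible F 2 →
      B16.EndStatementBPrinted (datumOfRecord₁₃CoPH F 2 θ hP).C → DagBinding.EndpointExistence (datumOfRecord₁₃CoPH F 2 θ hP).C.toB12 →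
        T4ContinuumYM4Torus.ForSmallCouplings (datumOfRecord₁₃CoPH F 2 θ hP) fun g₀ => ∀ os : List (ULoop F),
          0 < (cr F θ hP g₀ os).l₀ ∧ 0 < (cr F θ hP g₀ os).vol ∧
          (∀ (K : ℕ) (t : ℝ), |t| ≤ (cr F θ hP g₀ os).l₀ →
            T4GenFunBounds.schemeZ ((datumOfRecord₁₃CoPH F 2 θ hP).scheme g₀) os ((cr F θ hP g₀ os).K₀ + K) t =
              ∑ τ ∈ (cr F θ hP g₀ os).T K, (cr F θ hP g₀ os).A K t τ) ∧
          (∀ (K : ℕ) (t : ℝ), |t| ≤ (cr F θ hP g₀ os).l₀ →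
            T4GenFunBounds.schemeZ ((datumOfRecord₁₃CoPH F 2 θ hP).scheme g₀) os ((cr F θ hP g₀ os).K₀ + K + 1) t =
              ∑ τ ∈ (cr F θ hP g₀ os).T K, (cr F θ hP g₀ os).B K t τ))
    (hread : ∀ (F : T4Family) (θ : Stage13HParams F 2) (hP : θ.Provisos₁₃CoPH F 2), θ.ZhUnity F 2 ∧ θ.SlotsNondegenerate₁₃ F 2 → θ.Admissible F 2 →
      ∀ (g₀ : ℕ → ℝ) (os : List (ULoop F)),
      (∀ k : ℕ, RatesAt (datumOfRecord₁₃CoPH F 2 θ hP) (rateCarriersOfRecord₁₃CoPH 𝔯 F θ hP g₀ os k)) → letI := (cr F θ hP g₀ os).dec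
      0 < (cr F θ hP g₀ os).vol ∧
      (∀ K t, |t| ≤ (cr F θ hP g₀ os).l₀ → ∀ τ ∈ (cr F θ hP g₀ os).T K \ (cr F θ hP g₀ os).Bad K t,
        0 < (cr F θ hP g₀ os).A K t τ - (cr F θ hP g₀ os).shA K t τ ∧ 0 < (cr F θ hP g₀ os).B K t τ - (cr F θ hP g₀ os).shB K t τ) ∧
      ∃ (δ₀ Λ : ℕ → ℝ) (mA mB : ℕ → ℝ → (cr F θ hP g₀ os).ι → ℝ), Summable δ₀ ∧ Summable Λ ∧ (∀ K, 0 ≤ Λ K) ∧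
        (∀ K, ∃ c : ℝ, ∀ t : ℝ, |t| ≤ (cr F θ hP g₀ os).l₀ → ∀ τ ∈ (cr F θ hP g₀ os).T K \ (cr F θ hP g₀ os).Bad K t,
          |Real.log ((cr F θ hP g₀ os).B K 0 τ - (cr F θ hP g₀ os).shB K 0 τ) - Real.log ((cr F θ hP g₀ os).A K 0 τ - (cr F θ hP g₀ os).shA K 0 τ) - c| ≤
            (cr F θ hP g₀ os).vol * δ₀ K) ∧
        (∀ K, ∀ τ ∈ (cr F θ hP g₀ os).T K, ∀ s ∈ Set.Icc (-(cr F θ hP g₀ os).l₀) (cr F θ hP g₀ os).l₀,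
          HasDerivWithinAt (fun s => Real.log ((cr F θ hP g₀ os).A K s τ - (cr F θ hP g₀ os).shA K s τ)) (mA K s τ)
            (Set.Icc (-(cr F θ hP g₀ os).l₀) (cr F θ hP g₀ os).l₀) s) ∧
        (∀ K, ∀ τ ∈ (cr F θ hP g₀ os).T K, ∀ s ∈ Set.Icc (-(cr F θ hP g₀ os).l₀) (cr F θ hP g₀ os).l₀,
          HasDerivWithinAt (fun s => Real.log ((cr F θ hP g₀ os).B K s τ - (cr F θ hP g₀ os).shB K s τ)) (mB K s τ)
            (Set.Icc (-(cr F θ hP g₀ os).l₀) (cr F θ hP g₀ os).l₀) s) ∧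
        (∀ K (t : ℝ), |t| ≤ (cr F θ hP g₀ os).l₀ → ∀ τ ∈ (cr F θ hP g₀ os).T K \ (cr F θ hP g₀ os).Bad K t, ∀ s ∈ Set.uIcc (0 : ℝ) t,
          |mB K s τ - mA K s τ| ≤ Λ K)) :
    SpineGivenEndpointR13SepCoPH :=
  spineGivenEndpointR13SepCoPH_of_forall_guarded_matchingUnder_datumOfRecord₁₃CoPH fun F θ hP hG hθ =>
    matchingUnder_guarded_datumOfRecord₁₃CoPH_of_homes₁₃CoPHOn cr 𝔯 (fun F θ => θ.ZhUnity F 2 ∧ θ.SlotsNondegenerate₁₃ F 2) h14 h15 h16 h17 h18 h22 h20 h21 hx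
      (towerEdge₁₃CoPHOn_of_insertionDerivReading cr 𝔯 (fun F θ => θ.ZhUnity F 2 ∧ θ.SlotsNondegenerate₁₃ F 2) hread) F θ hP hG hθ

end GuardHomes

/-! ## §3 (v1.1, APPEND-ONLY; v1.7 edition over the CoPH homes 24ᶜᵒᴾᴴ∕24bᶜᵒᴾᴴ) The item from the stubs at the GUARD-restricted Stage-13 CoPH homes and a VACUUM-CORE ∕ MGF ∕ TILTED-MATCHING reading (module 24bᶜᵒᴾᴴ by name) -/

section VacuumMGF

open MeasureTheory
open T4OutputRate (Carriers Functional LipBackground NE5 NE9)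
open T4TowerRateComposition (PolyLipGrowth)
open T4CauchySum (InjectedRate)
open T4EtaRateMin (Readings NE3Shape)
open T4RateLiaison (GaugeDominated)
open Summit.QuantumFields.BalabanUV.T4Continuum.NE1p.DressedMGFForm (MGFForm TiltedMeanMatching)
open Summit.QuantumFields.YangMills.BalabanUVNodes.N19LedgerLinkSync (LedgerDataSync)
open Summit.QuantumFields.YangMills.BalabanUVNodes.N19LedgerPieces (TwoRunFormat LedgerBooking LedgerOtherKinds LedgerSize LedgerConventions)
open Summit.QuantumFields.YangMills.BalabanUVNodes.N19TargetAtHomes13CoPHOnVacuumMGF (matchingUnder_guarded_datumOfRecord₁₃CoPH_of_homes₁₃CoPHOn_vacuumMGF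
  matchingUnder_guarded_datumOfRecord₁₃CoPH_of_homes₁₃CoPHOn_vacuumLedgerPiecesMGF)

variable (cr : SpineReading₁₃CoPH 2) (𝔯 : RateReading₁₃CoPH 2)

/-- **K3⁷ FROM THE STUBS AT THE GUARD-RESTRICTED STAGE-13 CoPH HOMES AND A VACUUM-CORE ∕ MGF ∕ TILTED-MATCHING READING** [bookkeeping] (`N = 2`, regime = the item's guard
`θ.ZhUnity F 2 ∧ θ.SlotsNondegenerate₁₃ F 2`; §2's `spineGivenEndpointR13SepCoPH_of_homes₁₃CoPHOn_sourceSplit` with the source-split reading replaced): the six in-edges BY NAME at `RRec₁₃CoPHOn 𝔯 Rg`,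
`S_N20` ∕ `S_N21` at `SRec₁₃CoPHOn cr Rg`, the guarded keyed extraction clause, and — at every guarded admissible tuple, given the rates at every run length of `𝔯` — `0 < vol`, the VACUUM
shell-free cores' `NE7.Core` with summable `δ⁰`, MGF forms of both DRESSED shell-free cores, and N14's `TiltedMeanMatching η` with `Summable η` ⇒ `SpineGivenEndpointR13SepCoPH` (module 24bᶜᵒ
`matchingUnder_guarded_datumOfRecord₁₃CoPH_of_homes₁₃CoPHOn_vacuumMGF` ∘ `spineGivenEndpointR13SepCoPH_of_forall_guarded_matchingUnder_datumOfRecord₁₃CoPH`, one `h.toCore`).  Every input a HYPOTHESIS; (I) is N14's NE1′ residual, (V) any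
N19 knit on the vacuum cores; NOT NE7; the item is NOT claimed. [folklore] -/
theorem spineGivenEndpointR13SepCoPH_of_homes₁₃CoPHOn_vacuumMGF
    (h14 : S_N14 (RRec₁₃CoPHOn 𝔯 fun F θ => θ.ZhUnity F 2 ∧ θ.SlotsNondegenerate₁₃ F 2)) (h15 : S_N15 (RRec₁₃CoPHOn 𝔯 fun F θ => θ.ZhUnity F 2 ∧ θ.SlotsNondegenerate₁₃ F 2))
    (h16 : S_N16 (RRec₁₃CoPHOn 𝔯 fun F θ => θ.ZhUnity F 2 ∧ θ.SlotsNondegenerate₁₃ F 2)) (h17 : S_N17 (RRec₁₃CoPHOn 𝔯 fun F θ => θ.ZhUnity F 2 ∧ θ.SlotsNondegenerate₁₃ F 2))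
    (h18 : S_N18 (RRec₁₃CoPHOn 𝔯 fun F θ => θ.ZhUnity F 2 ∧ θ.SlotsNondegenerate₁₃ F 2)) (h22 : S_N22 (RRec₁₃CoPHOn 𝔯 fun F θ => θ.ZhUnity F 2 ∧ θ.SlotsNondegenerate₁₃ F 2))
    (h20 : S_N20 (SRec₁₃CoPHOn cr fun F θ => θ.ZhUnity F 2 ∧ θ.SlotsNondegenerate₁₃ F 2)) (h21 : S_N21 (SRec₁₃CoPHOn cr fun F θ => θ.ZhUnity F 2 ∧ θ.SlotsNondegenerate₁₃ F 2))
    (hx : ∀ (F : T4Family) (θ : Stage13HParams F 2) (hP : θ.Provisos₁₃CoPH F 2), θ.ZhUnity F 2 ∧ θ.SlotsNondegenerate₁₃ F 2 → θ.Admissible F 2 →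
      B16.EndStatementBPrinted (datumOfRecord₁₃CoPH F 2 θ hP).C → DagBinding.EndpointExistence (datumOfRecord₁₃CoPH F 2 θ hP).C.toB12 →
        T4ContinuumYM4Torus.ForSmallCouplings (datumOfRecord₁₃CoPH F 2 θ hP) fun g₀ => ∀ os : List (ULoop F),
          0 < (cr F θ hP g₀ os).l₀ ∧ 0 < (cr F θ hP g₀ os).vol ∧
          (∀ (K : ℕ) (t : ℝ), |t| ≤ (cr F θ hP g₀ os).l₀ →
            T4GenFunBounds.schemeZ ((datumOfRecord₁₃CoPH F 2 θ hP).scheme g₀) os ((cr F θ hP g₀ os).K₀ + K) t =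
              ∑ τ ∈ (cr F θ hP g₀ os).T K, (cr F θ hP g₀ os).A K t τ) ∧
          (∀ (K : ℕ) (t : ℝ), |t| ≤ (cr F θ hP g₀ os).l₀ →
            T4GenFunBounds.schemeZ ((datumOfRecord₁₃CoPH F 2 θ hP).scheme g₀) os ((cr F θ hP g₀ os).K₀ + K + 1) t =
              ∑ τ ∈ (cr F θ hP g₀ os).T K, (cr F θ hP g₀ os).B K t τ))
    (hread : ∀ (F : T4Family) (θ : Stage13HParams F 2) (hP : θ.Provisos₁₃CoPH F 2), θ.ZhUnity F 2 ∧ θ.SlotsNondegenerate₁₃ F 2 → θ.Admissible F 2 →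
      ∀ (g₀ : ℕ → ℝ) (os : List (ULoop F)),
      (∀ k : ℕ, RatesAt (datumOfRecord₁₃CoPH F 2 θ hP) (rateCarriersOfRecord₁₃CoPH 𝔯 F θ hP g₀ os k)) → letI := (cr F θ hP g₀ os).dec
      0 < (cr F θ hP g₀ os).vol ∧
      ∃ (δ₀ η : ℕ → ℝ) (Ω Ω' : ℕ → Type) (_ : ∀ K, MeasurableSpace (Ω K)) (_ : ∀ K, MeasurableSpace (Ω' K)) (Bo : ℝ)
        (Fo : ∀ K, Ω K → ℝ) (ν : ∀ K, (cr F θ hP g₀ os).ι → Measure (Ω K)) (Fo' : ∀ K, Ω' K → ℝ) (ν' : ∀ K, (cr F θ hP g₀ os).ι → Measure (Ω' K)),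
        NE7.Core (cr F θ hP g₀ os).l₀ (cr F θ hP g₀ os).vol (cr F θ hP g₀ os).T (cr F θ hP g₀ os).Bad
          (fun K _ τ => (cr F θ hP g₀ os).A K 0 τ - (cr F θ hP g₀ os).shA K 0 τ) (fun K _ τ => (cr F θ hP g₀ os).B K 0 τ - (cr F θ hP g₀ os).shB K 0 τ) δ₀ ∧
        Summable δ₀ ∧
        MGFForm Bo (cr F θ hP g₀ os).T Fo ν (fun K t τ => (cr F θ hP g₀ os).A K t τ - (cr F θ hP g₀ os).shA K t τ) ∧
        MGFForm Bo (cr F θ hP g₀ os).T Fo' ν' (fun K t τ => (cr F θ hP g₀ os).B K t τ - (cr F θ hP g₀ os).shB K t τ) ∧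
        TiltedMeanMatching (cr F θ hP g₀ os).l₀ (cr F θ hP g₀ os).T (cr F θ hP g₀ os).Bad Fo ν Fo' ν' η ∧ Summable η) :
    SpineGivenEndpointR13SepCoPH :=
  spineGivenEndpointR13SepCoPH_of_forall_guarded_matchingUnder_datumOfRecord₁₃CoPH fun F θ hP hG hθ =>
    matchingUnder_guarded_datumOfRecord₁₃CoPH_of_homes₁₃CoPHOn_vacuumMGF cr 𝔯 (fun F θ => θ.ZhUnity F 2 ∧ θ.SlotsNondegenerate₁₃ F 2)
      h14 h15 h16 h17 h18 h22 h20 h21 hx hread F θ hP hG hθ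

/-- **K3⁷ FROM THE STUBS AT THE GUARD-RESTRICTED STAGE-13 CoPH HOMES AND NODE O's VACUUM LEDGER PIECES** [bookkeeping] (`N = 2`; the same with the vacuum `Core` PRODUCED by the
ledger road at the pieces of record): at every guarded admissible tuple, given the rates, `0 < vol` and ledger data `L`, readings `R` and letters with F1 `TwoRunFormat` · F2
`LedgerBooking` · F3 `LedgerOtherKinds` · S `LedgerSize` · C `LedgerConventions` ON THE VACUUM shell-free cores of `cr F θ hP g₀ os`, the remaining kinds in SPECIES FORM (one-run
first-step bound, constants' deviation datum — F3′ no longer a hypothesis), the in-edge letters (N16 `NE3Shape` + `GaugeDominated`, N18 `NE5`, N22 `NE9 ∧ FadingMemory`, N17∕U2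
`InjectedRate`, box, (T) `LipBackground` + `PolyLipGrowth`, window), MGF forms of both dressed shell-free cores and N14's `TiltedMeanMatching η` with `Summable η` ⇒
`SpineGivenEndpointR13SepCoPH` (module 24bᶜᵒᴾᴴ `matchingUnder_guarded_datumOfRecord₁₃CoPH_of_homes₁₃CoPHOn_vacuumLedgerPiecesMGF` ∘ `spineGivenEndpointR13SepCoPH_of_forall_guarded_matchingUnder_datumOfRecord₁₃CoPH`, one `h.toCore`).  What NODE O's
vacuum instance at the v1.7 Stage-13 tuples must hand, BY NAME, with NO observable and NO unprinted estimate inside N19.  Every input a HYPOTHESIS; the item is NOT claimed. [folklore] -/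
theorem spineGivenEndpointR13SepCoPH_of_homes₁₃CoPHOn_vacuumLedgerPiecesMGF
    (h14 : S_N14 (RRec₁₃CoPHOn 𝔯 fun F θ => θ.ZhUnity F 2 ∧ θ.SlotsNondegenerate₁₃ F 2)) (h15 : S_N15 (RRec₁₃CoPHOn 𝔯 fun F θ => θ.ZhUnity F 2 ∧ θ.SlotsNondegenerate₁₃ F 2))
    (h16 : S_N16 (RRec₁₃CoPHOn 𝔯 fun F θ => θ.ZhUnity F 2 ∧ θ.SlotsNondegenerate₁₃ F 2)) (h17 : S_N17 (RRec₁₃CoPHOn 𝔯 fun F θ => θ.ZhUnity F 2 ∧ θ.SlotsNondegenerate₁₃ F 2))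
    (h18 : S_N18 (RRec₁₃CoPHOn 𝔯 fun F θ => θ.ZhUnity F 2 ∧ θ.SlotsNondegenerate₁₃ F 2)) (h22 : S_N22 (RRec₁₃CoPHOn 𝔯 fun F θ => θ.ZhUnity F 2 ∧ θ.SlotsNondegenerate₁₃ F 2))
    (h20 : S_N20 (SRec₁₃CoPHOn cr fun F θ => θ.ZhUnity F 2 ∧ θ.SlotsNondegenerate₁₃ F 2)) (h21 : S_N21 (SRec₁₃CoPHOn cr fun F θ => θ.ZhUnity F 2 ∧ θ.SlotsNondegenerate₁₃ F 2))
    (hx : ∀ (F : T4Family) (θ : Stage13HParams F 2) (hP : θ.Provisos₁₃CoPH F 2), θ.ZhUnity F 2 ∧ θ.SlotsNondegenerate₁₃ F 2 → θ.Admissible F 2 →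
      B16.EndStatementBPrinted (datumOfRecord₁₃CoPH F 2 θ hP).C → DagBinding.EndpointExistence (datumOfRecord₁₃CoPH F 2 θ hP).C.toB12 →
        T4ContinuumYM4Torus.ForSmallCouplings (datumOfRecord₁₃CoPH F 2 θ hP) fun g₀ => ∀ os : List (ULoop F),
          0 < (cr F θ hP g₀ os).l₀ ∧ 0 < (cr F θ hP g₀ os).vol ∧
          (∀ (K : ℕ) (t : ℝ), |t| ≤ (cr F θ hP g₀ os).l₀ →
            T4GenFunBounds.schemeZ ((datumOfRecord₁₃CoPH F 2 θ hP).scheme g₀) os ((cr F θ hP g₀ os).K₀ + K) t =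
              ∑ τ ∈ (cr F θ hP g₀ os).T K, (cr F θ hP g₀ os).A K t τ) ∧
          (∀ (K : ℕ) (t : ℝ), |t| ≤ (cr F θ hP g₀ os).l₀ →
            T4GenFunBounds.schemeZ ((datumOfRecord₁₃CoPH F 2 θ hP).scheme g₀) os ((cr F θ hP g₀ os).K₀ + K + 1) t =
              ∑ τ ∈ (cr F θ hP g₀ os).T K, (cr F θ hP g₀ os).B K t τ))
    (hread : ∀ (F : T4Family) (θ : Stage13HParams F 2) (hP : θ.Provisos₁₃CoPH F 2), θ.ZhUnity F 2 ∧ θ.SlotsNondegenerate₁₃ F 2 → θ.Admissible F 2 →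
      ∀ (g₀ : ℕ → ℝ) (os : List (ULoop F)),
      (∀ k : ℕ, RatesAt (datumOfRecord₁₃CoPH F 2 θ hP) (rateCarriersOfRecord₁₃CoPH 𝔯 F θ hP g₀ os k)) → letI := (cr F θ hP g₀ os).dec
      0 < (cr F θ hP g₀ os).vol ∧
      ∃ (C : Carriers) (_ : DecidableEq C.Dom) (F' : Type) (ι' X' : Type) (_ : MeasurableSpace ι')
        (L : LedgerDataSync C F' ι' (cr F θ hP g₀ os).ι) (R : Readings ι' X') (W : Set (ℕ → ℝ)) (EA : Functional C C.BgA)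
        (EB : Functional C C.BgB) (κ θ₅ C₅ C₉ ω θc Cd γ C₃ θ₃ Pg : ℝ) (q : ℕ) (Λm : ℕ → ℕ → ℝ)
        (CU : (ℕ → ℝ) → ℕ → ℝ) (g : ℕ → ℕ → ℝ) (uA : ℕ → ι' → C.BgA) (uB : ℕ → ι' → C.BgB)
        (Φ : ℕ → ℝ → (cr F θ hP g₀ os).ι → ι' → ℝ) (e ρ : ℕ → ℝ) (α β : ℕ → ℝ → (cr F θ hP g₀ os).ι → ℝ)
        (η : ℕ → ℝ) (Ω Ω' : ℕ → Type) (_ : ∀ K, MeasurableSpace (Ω K)) (_ : ∀ K, MeasurableSpace (Ω' K)) (Bo : ℝ)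
        (Fo : ∀ K, Ω K → ℝ) (ν : ∀ K, (cr F θ hP g₀ os).ι → Measure (Ω K)) (Fo' : ∀ K, Ω' K → ℝ) (ν' : ∀ K, (cr F θ hP g₀ os).ι → Measure (Ω' K)),
        (TwoRunFormat L (cr F θ hP g₀ os).l₀ (cr F θ hP g₀ os).T (cr F θ hP g₀ os).Bad
            (fun K _ τ => (cr F θ hP g₀ os).A K 0 τ - (cr F θ hP g₀ os).shA K 0 τ) (fun K _ τ => (cr F θ hP g₀ os).B K 0 τ - (cr F θ hP g₀ os).shB K 0 τ) R EA EB g uA uB ∧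
          LedgerBooking L (cr F θ hP g₀ os).l₀ (cr F θ hP g₀ os).vol (cr F θ hP g₀ os).T (cr F θ hP g₀ os).Bad κ ∧
          LedgerOtherKinds L (cr F θ hP g₀ os).l₀ (cr F θ hP g₀ os).vol (cr F θ hP g₀ os).T (cr F θ hP g₀ os).Bad R EA EB g ∧
          LedgerSize L (cr F θ hP g₀ os).l₀ (cr F θ hP g₀ os).vol (cr F θ hP g₀ os).T (cr F θ hP g₀ os).Bad R EA EB g uA uB ∧
          LedgerConventions L (cr F θ hP g₀ os).vol R ω θc θ₅ θ₃) ∧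
        ((∀ K t τ v, L.oA'' K t τ v = Real.exp (α K t τ)) ∧
          (∀ K t τ v, L.oB'' K t τ v = Real.exp (Φ K t τ v + e K) * Real.exp (β K t τ)) ∧
          (∀ K t τ, L.cO'' K t τ = e K + (β K t τ - α K t τ)) ∧ (∀ K t τ, L.RO'' K t τ = (cr F θ hP g₀ os).vol * ρ K) ∧ L.rO'' = ρ ∧
          (∀ K t, |t| ≤ (cr F θ hP g₀ os).l₀ → ∀ τ ∈ (cr F θ hP g₀ os).T K \ (cr F θ hP g₀ os).Bad K t, ∀ v ∈ R.dom,
            |Φ K t τ v| ≤ (cr F θ hP g₀ os).vol * ρ K) ∧ Summable ρ ∧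
          (∃ b₀ s : ℕ → ℝ, Summable s ∧ ∀ K t, |t| ≤ (cr F θ hP g₀ os).l₀ → ∀ τ ∈ (cr F θ hP g₀ os).T K \ (cr F θ hP g₀ os).Bad K t,
            |β K t τ - α K t τ - b₀ K| ≤ (cr F θ hP g₀ os).vol * s K)) ∧
        (NE3Shape R C₃ θ₃ ∧ 0 ≤ C₃ ∧ GaugeDominated R uA uB ∧
          NE5 EA EB W κ θ₅ C₅ ∧ 0 ≤ θ₅ ∧ 0 ≤ C₅ ∧
          (NE9 EA W κ Λm ∧ T4OutputRate.FadingMemory C₉ ω Λm) ∧ 0 ≤ ω ∧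
          InjectedRate Cd 0 θc (fun K j => T4CouplingMatching.disc (g K) (g (K + 1)) j) ∧ 0 ≤ Cd ∧ 0 ≤ θc ∧
          (∀ K i, i ≤ K → 0 < g K i ∧ g K i ≤ γ) ∧
          LipBackground EA W κ CU ∧ PolyLipGrowth CU g Pg q ∧ 0 ≤ Pg ∧
          (∀ K, g K ∈ W) ∧ (∀ K, (fun i => g (K + 1) (i + 1)) ∈ W)) ∧
        (MGFForm Bo (cr F θ hP g₀ os).T Fo ν (fun K t τ => (cr F θ hP g₀ os).A K t τ - (cr F θ hP g₀ os).shA K t τ) ∧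
          MGFForm Bo (cr F θ hP g₀ os).T Fo' ν' (fun K t τ => (cr F θ hP g₀ os).B K t τ - (cr F θ hP g₀ os).shB K t τ) ∧
          TiltedMeanMatching (cr F θ hP g₀ os).l₀ (cr F θ hP g₀ os).T (cr F θ hP g₀ os).Bad Fo ν Fo' ν' η ∧ Summable η)) :
    SpineGivenEndpointR13SepCoPH :=
  spineGivenEndpointR13SepCoPH_of_forall_guarded_matchingUnder_datumOfRecord₁₃CoPH fun F θ hP hG hθ =>
    matchingUnder_guarded_datumOfRecord₁₃CoPH_of_homes₁₃CoPHOn_vacuumLedgerPiecesMGF cr 𝔯 (fun F θ => θ.ZhUnity F 2 ∧ θ.SlotsNondegenerate₁₃ F 2)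
      h14 h15 h16 h17 h18 h22 h20 h21 hx hread F θ hP hG hθ

end VacuumMGF

end Summit.QuantumFields.YangMills.BalabanUVNodes.N19TargetK3R13SepCoPHReading
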